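import Literature.NumberTheory.ModularSymbols.FullLevelHomologySpreadLattice
import Literature.NumberTheory.ModularSymbols.FullLevelHomologyHeckeComparison
import HarnessLib

/-!
# `Λ_Q(f)` is Hecke: under the period maps `T_q^{up}` acts by the eigenvalue `a_q(f)`

Topic `Literature/NumberTheory/ModularSymbols`; namespace `Literature.NumberTheory.ModularSymbols(.FullLevel)`; sequel of
`FullLevelHomologySpreadLattice` (`periodMapLattice`, `periodClassK`, `torusPeriodClass`, `spreadPeriod`, `spreadLattice`) and
`FullLevelHomologyHeckeComparison` (`heckeComparison`).  Proved theorems only; no named fact, no `sorry`.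

* `periodMapLattice_smul_of_eigen`, **`periodClassK_heckeOp_of_eigen`**: for a `T_q`-eigenform `f` with INTEGER eigenvalue `a`
  (`T_q f = a f`), `periodClassK f (T_q x) = a · periodClassK f x` on `H(N; R)`.
* `heckeT_avgProj`, `heckeTInvariants_toInvariants` (`T_q` commutes with the averaging projector onto `T̃`-invariants),
  **`torusPeriodClass_heckeTInvariants`**: `torusPeriodClass f (T_q z) = a · torusPeriodClass f z`, and
  **`spreadPeriod_heckeT`**: `spreadPeriod f (T_q z) = a · spreadPeriod f z` on the whole carrier `H₁(Γ₀(M), k[GL₂(ℤ/p)])`;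
  `spreadPeriod_heckeT_sub` (`spreadPeriod f ∘ (T_q − a) = 0`): the K-line lattice `Λ_Q(f) = range (spreadPeriod f)` is a quotient
  of the `T_q = a_q(f)` co-eigenspace of the carrier, for every prime `q ≠ p` (route BSD/TeichmullerTwistDescent, audit (S2)–(S4):
  «𝔭_W-parts upstairs ↦ f_W-parts downstairs»).  Nothing about any elliptic curve is asserted.

## References
* G. Shimura, *Introduction to the arithmetic theory of automorphic functions* (1971), §8.3 (8.3.2) and Thm 3.41. [Shimura1971]
* A. Ash, G. Stevens, Duke Math. J. 53 (1986), §1 (1.4). [AshStevens1986]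
* A. W. Knapp, *Elliptic Curves* (1993), (11.38), Prop. 11.23. [Knapp1993]
-/

noncomputable section

namespace Literature.NumberTheory.ModularSymbols

open scoped MatrixGroups TensorProduct
open CategoryTheory CongruenceSubgroup groupHomology
open Literature.Algebra.Homology
open Literature.NumberTheory.EllipticCurves.ModularForms

section Downstairs

variable (N : ℕ) [NeZero N]

/-- Integer eigenvalues pass to the lattice-valued period map: `T f = a f ⟹ Λ-period of T•x = a · Λ-period of x`.
[cite: Shimura1971, Thm 3.41; Knapp1993, (11.38)] -/
theorem periodMapLattice_smul_of_eigen {T : HeckeRing0 N 2} {f : CuspForm (Gamma0 N) 2} {a : ℤ}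
    (hT : HeckeRing0.toEnd N 2 T f = (a : ℂ) • f) (x : periodHomologyHecke N) :
    periodMapLattice N f (T • x) = a • periodMapLattice N f x := by
  apply Subtype.ext
  rw [coe_periodMapLattice, periodMap_smul_of_eigen N hT, Submodule.coe_smul, coe_periodMapLattice, zsmul_eq_mul]

/-- **`periodClassK f ∘ T_q = a_q · periodClassK f`** on `H(N; R)` for a `T_q`-eigenform with integer eigenvalue.
[cite: Shimura1971, §8.3 (8.3.2) and Thm 3.41] -/
theorem periodClassK_heckeOp_of_eigen (R : Type) [CommRing R] {q : ℕ} (hq : q.Prime) {f : CuspForm (Gamma0 N) 2} {a : ℤ}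
    (hT : HeckeRing0.toEnd N 2 (HeckeRing0.T N 2 q hq) f = (a : ℂ) • f) (x : CuspidalHomologyHeckeModule N R) :
    periodClassK N R f (heckeOp N R q hq x) = (a : R) • periodClassK N R f x := by
  rw [heckeOp_def]
  induction x using TensorProduct.induction_on with
  | zero => simp
  | add x y hx hy => rw [map_add, map_add, hx, hy, map_add, smul_add]
  | tmul r x =>
    rw [hecke_tmul, periodClassK_tmul, periodClassK_tmul, periodMapLattice_smul_of_eigen N hT, TensorProduct.tmul_smul]
    exact (Int.cast_smul_eq_zsmul R a _).symm

end Downstairs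

namespace FullLevel

variable (k : Type) [CommRing k] (p M : ℕ) [Fact p.Prime] (hpM : Nat.Coprime p M) {q : ℕ} [NeZero q] (hq : q.Prime) (hqp : q ≠ p)
  [Fintype (diagTorus (ZMod p))] [Invertible (Fintype.card (diagTorus (ZMod p)) : k)]

/-- `T_q` commutes with the averaging projector onto the `T̃`-invariants. [cite: AshStevens1986, §1 (1.4)] -/
theorem heckeT_avgProj (z : H1carrier k p M) :
    heckeT k p M hq hqp (PermutationCoeff.avgProj (redGL p M) (diagTorus (ZMod p)) z) =
      PermutationCoeff.avgProj (redGL p M) (diagTorus (ZMod p)) (heckeT k p M hq hqp z) := by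
  simp only [PermutationCoeff.avgProj, LinearMap.smul_apply, LinearMap.sum_apply, map_smul, map_sum]
  congr 1
  refine Finset.sum_congr rfl fun t _ => ?_
  exact heckeT_H1carrierRep k p M hq hqp (t : GL (Fin 2) (ZMod p)) z

/-- `T_q ∘ toInvariants = toInvariants ∘ T_q`. [cite: AshStevens1986, §1 (1.4)] -/
theorem heckeTInvariants_toInvariants (z : H1carrier k p M) :
    heckeTInvariants k p M hq hqp (diagTorus (ZMod p)) (PermutationCoeff.toInvariants (redGL p M) (diagTorus (ZMod p)) z) =
      PermutationCoeff.toInvariants (redGL p M) (diagTorus (ZMod p)) (heckeT k p M hq hqp z) := by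
  apply Subtype.ext
  rw [coe_heckeTInvariants, PermutationCoeff.coe_toInvariants, PermutationCoeff.coe_toInvariants, heckeT_avgProj]

variable [NeZero M]

/-- **`torusPeriodClass f (T_q z) = a_q · torusPeriodClass f z`** for a `T_q`-eigenform `f ∈ S₂(Γ₀(p²M))` with integer
eigenvalue `a` (Hecke comparison + eigen-property of periods). [cite: Shimura1971, §8.3 (8.3.2); AshStevens1986, §1 (1.4)] -/
theorem torusPeriodClass_heckeTInvariants {f : CuspForm (Gamma0 (p ^ 2 * M)) 2} {a : ℤ}
    (hT : HeckeRing0.toEnd (p ^ 2 * M) 2 (HeckeRing0.T (p ^ 2 * M) 2 q hq) f = (a : ℂ) • f)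
    (z : PermutationCoeff.H1Invariants k (redGL p M) (diagTorus (ZMod p))) :
    torusPeriodClass k p M hpM f (heckeTInvariants k p M hq hqp (diagTorus (ZMod p)) z) = (a : k) • torusPeriodClass k p M hpM f z := by
  haveI : NeZero (p ^ 2 * M) := neZero_sq_mul p M
  rw [torusPeriodClass, LinearMap.comp_apply, LinearMap.comp_apply, heckeComparison p M hpM hq hqp k z]
  exact periodClassK_heckeOp_of_eigen (p ^ 2 * M) k hq hT _

/-- **`spreadPeriod f (T_q z) = a_q · spreadPeriod f z`** on the whole carrier `H₁(Γ₀(M), k[GL₂(ℤ/p)])`.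
[cite: Shimura1971, §8.3 (8.3.2); AshStevens1986, §1 (1.4)] -/
theorem spreadPeriod_heckeT {f : CuspForm (Gamma0 (p ^ 2 * M)) 2} {a : ℤ}
    (hT : HeckeRing0.toEnd (p ^ 2 * M) 2 (HeckeRing0.T (p ^ 2 * M) 2 q hq) f = (a : ℂ) • f) (z : H1carrier k p M) :
    spreadPeriod k p M hpM f (heckeT k p M hq hqp z) = (a : k) • spreadPeriod k p M hpM f z := by
  funext g
  rw [spreadPeriod, PermutationCoeff.spread_apply, Pi.smul_apply, PermutationCoeff.spread_apply,
    ← torusPeriodClass_heckeTInvariants k p M hpM hq hqp hT, heckeTInvariants_toInvariants]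
  congr 2
  exact (heckeT_H1carrierRep k p M hq hqp g z).symm

/-- `spreadPeriod f ∘ (T_q − a_q) = 0`: the lattice `Λ_Q(f) = range (spreadPeriod f)` is a quotient of the `T_q = a_q(f)`
co-eigenspace of `H₁(Γ₀(M), k[GL₂(ℤ/p)])`. [cite: Shimura1971, §8.3; AshStevens1986, §1 (1.4)] -/
theorem spreadPeriod_heckeT_sub {f : CuspForm (Gamma0 (p ^ 2 * M)) 2} {a : ℤ}
    (hT : HeckeRing0.toEnd (p ^ 2 * M) 2 (HeckeRing0.T (p ^ 2 * M) 2 q hq) f = (a : ℂ) • f) :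
    (spreadPeriod k p M hpM f).comp (heckeT k p M hq hqp - (a : k) • LinearMap.id) = 0 := by
  ext z : 1
  rw [LinearMap.comp_apply, LinearMap.sub_apply, map_sub, spreadPeriod_heckeT k p M hpM hq hqp hT, LinearMap.smul_apply,
    LinearMap.id_apply, map_smul, sub_self, LinearMap.zero_apply]

end FullLevel

end Literature.NumberTheory.ModularSymbols
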